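import Summits.AtomisticToContinuum.HydrodynamicLimit.Theses.AntiMazurCoboundaries
import Literature.MathematicalPhysics.KineticTheory.HardSphereEulerProofs
import Literature.MathematicalPhysics.KineticTheory.HardBallErgodicity
import Summits.AtomisticToContinuum.HydrodynamicLimit.Theorems.CorrectorPressureDecay.Negative.OrthEnergyTools

/-!
# Stub `stub_shellChernoff` of line `almost-invariant-duality` — crux `AntiMazurCoboundaries.CorrectorPressureDecay`
(stmt-AtomisticToContinuum-14135)

Helper file (`--supports stmt-AtomisticToContinuum-14135`) proving the registered stub `stub_shellChernoff` of the lead's skeleton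
`Cruxes/CorrectorPressureDecay/Lines/almost-invariant-duality.lean`: under the constant-profile local Gibbs law `G_N` (`σ ≤ 1/2`) the
shell distance `ω = min 1 (‖p̂‖² + (ê/3 - 1)²)` (`p̂`, `ê` the reduced empirical momentum / kinetic energy per particle) has
`E exp(A n ω) ≤ e^{δ n}` for `0 ≤ A ≤ A₀ := 1/12`, `δ > 0`, `n = N + 1 ≥ N₀(A, δ)`. Proof summary:
* *Transfer* (`lintegral_vel_localGibbsMeasure`): a velocity functional integrates under `G_N` as under `⊗ᵢ N(u₀, θ)` (tree:
  `lintegral_localGibbsMeasure`, `lintegral_posWeight_eq_one`), the image of `γ = ⊗ᵢ γ₃ = piGauss N` under `wᵢ ↦ u₀ + √θ wᵢ`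
  (`Measure.pi_map_pi`); in the reduced velocities the integrand is `exp(A n ω̃)`, `ω̃(w) = min 1 (‖n⁻¹∑wᵢ‖² + (n⁻¹∑‖wᵢ‖²/3 - 1)²)`.
* *Chernoff tails under `γ`* (`measure_ge_le_exp_mul_mgf`): mgf's `E e^{t∑ᵢwᵢₖ} = e^{nt²/2}` and `E e^{t∑ᵢ‖wᵢ‖²} = (1-2t)^{-3n/2}`
  (coordinatewise Gaussian integrals of `Negative/OrthMomentumTools`, `…/OrthEnergyTools`) give `P(±∑ᵢwᵢₖ ≥ nρ) ≤ e^{-nρ²/2}` and,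
  with `t = r/6` and `log(1 - x) ≥ -x - (3/2)x²` (`|x| ≤ 1/2`, `Real.abs_log_sub_add_sum_range_le`),
  `P(±(∑ᵢ‖wᵢ‖² - 3n) ≥ 3nr) ≤ e^{-nr²/4}` (`0 ≤ r ≤ 3/2`); a union bound over `3·2 + 2` events: `P(ω̃ ≥ v) ≤ 8e^{-nv/12}`, `0 ≤ v ≤ 1`.
* *Layer cake on a finite grid* (`lintegral_exp_shell_le`): `J = ⌈4A/δ⌉₊ + 1` levels `j/J`; pointwise
  `e^{Anω̃} ≤ ∑_{j ≤ J} 1{j/J ≤ ω̃} e^{An(j+1)/J}`; `A ≤ 1/12` makes each level contribute `≤ 8e^{An/J} ≤ 8e^{δn/4}`, and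
  `8(J+1)e^{δn/4} ≤ e^{δn}` once `n ≥ 4 log(8(J+1))/(3δ)`.
-/

noncomputable section

open MeasureTheory ProbabilityTheory Set Filter Topology
open scoped ENNReal

namespace Summit.AtomisticToContinuum.HydrodynamicLimit.Theorems.AlmostInvariantDuality

open Literature.MathematicalPhysics.KineticTheory (T3 V3 hsDiameter localGibbsLaw)
open Literature.Analysis.FluidPDE (HardSphereFlow Config configMomentum configEnergy)
open Summit.AtomisticToContinuum.HydrodynamicLimit.Theorems.CorrectorPressureDecayNegative.OrthMomentum (piGauss
  integral_coord_stdGaussian)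
open Summit.AtomisticToContinuum.HydrodynamicLimit.Theorems.CorrectorPressureDecayNegative.OrthEnergy
  (integral_prod_coord_stdGaussian exp_neg_mul_norm_sq_eq_prod integral_exp_neg_mul_sq_gaussianReal)
open Summit.AtomisticToContinuum.HydrodynamicLimit.Theorems.BoltzmannGreenKuboOrthMomentum (integral_exp_mul_gaussianReal)

/-! ## One-dimensional analysis -/

/-- `log (1 - x) ≥ -x - (3/2) x²` for `|x| ≤ 1/2` (second-order Taylor remainder of `log`). -/
theorem neg_sub_sq_le_log_one_sub {x : ℝ} (hx : |x| ≤ 1 / 2) : -x - 3 / 2 * x ^ 2 ≤ Real.log (1 - x) := by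
  have h := Real.abs_log_sub_add_sum_range_le (hx.trans_lt (by norm_num)) 2
  have hs : (∑ i ∈ Finset.range 2, x ^ (i + 1) / ((i : ℝ) + 1)) = x + x ^ 2 / 2 := by
    rw [Finset.sum_range_succ, Finset.sum_range_one]
    norm_num
  rw [hs] at h
  have h3 : |x| ^ (2 + 1) / (1 - |x|) ≤ x ^ 2 := by
    rw [div_le_iff₀ (by linarith), pow_succ, sq_abs]
    nlinarith [sq_nonneg x, abs_nonneg x]
  have := (abs_le.1 (h.trans h3)).1
  linarith

/-- One-body Chernoff factor of the kinetic energy at `t = r/6`: `e^{-3t(r+c)} (1 - 2ct)^{-3/2} ≤ e^{-r²/4}` for `c = ±1`,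
`0 ≤ r ≤ 3/2`. -/
theorem energy_oneBody_bound {c r : ℝ} (hc : c ^ 2 = 1) (hr0 : 0 ≤ r) (hr : r ≤ 3 / 2) :
    Real.exp (-(r / 6) * (3 * (r + c))) * ((Real.sqrt (1 - 2 * (r / 6 * c)))⁻¹ ^ 3) ≤ Real.exp (-(r ^ 2 / 4)) := by
  have habs : |c| = 1 := (pow_eq_one_iff_of_nonneg (abs_nonneg c) two_ne_zero).1 (by rw [← sq_abs] at hc; exact hc)
  set x : ℝ := r / 3 * c with hx
  have hxabs : |x| ≤ 1 / 2 := by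
    rw [hx, abs_mul, habs, mul_one, abs_of_nonneg (by positivity)]
    linarith
  have hy : 0 < 1 - x := by have := (abs_le.1 hxabs).2; linarith
  have hlog := neg_sub_sq_le_log_one_sub hxabs
  have hsqrt : (Real.sqrt (1 - 2 * (r / 6 * c)))⁻¹ ^ 3 = Real.exp (-(3 / 2) * Real.log (1 - x)) := by
    rw [show 1 - 2 * (r / 6 * c) = 1 - x by rw [hx]; ring, Real.sqrt_eq_rpow, Real.rpow_def_of_pos hy, ← Real.exp_neg,
      ← Real.exp_nat_mul]
    congr 1
    push_cast
    ring
  rw [hsqrt, ← Real.exp_add, Real.exp_le_exp]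
  have hx2 : x ^ 2 = r ^ 2 / 9 := by rw [hx, mul_pow, hc]; ring
  have hrc : r * c = 3 * x := by rw [hx]; ring
  nlinarith [hlog, hx2, hrc]

/-! ## Moment generating functions and Chernoff tails under the product Gaussian `piGauss N = ⊗ᵢ γ₃` -/

/-- mgf of one coordinate of the total momentum: `∫ e^{β ∑ᵢ wᵢₖ} dγ = (e^{β²/2})^{N+1}`. -/
theorem integral_exp_mul_sum_coord' (N : ℕ) (k : Fin 3) (β : ℝ) :
    ∫ w, Real.exp (β * ∑ i, w i k) ∂piGauss N = Real.exp (β ^ 2 / 2) ^ (N + 1) := by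
  simp_rw [Finset.mul_sum, Real.exp_sum]
  rw [integral_fintype_prod_eq_prod (fun (_ : Fin (N + 1)) (v : V3) => Real.exp (β * v k))]
  simp only [Finset.prod_const, Finset.card_univ, Fintype.card_fin]
  rw [integral_coord_stdGaussian k (by fun_prop : Measurable fun x : ℝ => Real.exp (β * x)), integral_exp_mul_gaussianReal]

/-- mgf of the kinetic energy: `∫ e^{β ∑ᵢ ‖wᵢ‖²} dγ = (1 - 2β)^{-3(N+1)/2}` for `β < 1/2`. -/
theorem integral_exp_mul_sum_norm_sq (N : ℕ) {β : ℝ} (hβ : β < 1 / 2) :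
    ∫ w, Real.exp (β * ∑ i, ‖w i‖ ^ 2) ∂piGauss N = ((Real.sqrt (1 - 2 * β))⁻¹ ^ 3) ^ (N + 1) := by
  have h3 : ∀ v : V3, Real.exp (β * ‖v‖ ^ 2) = ∏ k : Fin 3, Real.exp (-(-2 * β / 2) * (v k) ^ 2) := by
    intro v
    rw [← exp_neg_mul_norm_sq_eq_prod]
    congr 1
    ring
  simp_rw [Finset.mul_sum, Real.exp_sum]
  rw [integral_fintype_prod_eq_prod (fun (_ : Fin (N + 1)) (v : V3) => Real.exp (β * ‖v‖ ^ 2))]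
  simp only [Finset.prod_const, Finset.card_univ, Fintype.card_fin]
  simp_rw [h3]
  rw [integral_prod_coord_stdGaussian (fun _ x => Real.exp (-(-2 * β / 2) * x ^ 2)) (fun _ => by fun_prop), Finset.prod_const,
    Finset.card_univ, Fintype.card_fin, integral_exp_neg_mul_sq_gaussianReal (by linarith), show 1 + -2 * β = 1 - 2 * β by ring]

/-- Chernoff's bound in `ℝ≥0∞` form, with integrability read off from a nonzero mgf. -/
theorem measure_ge_le_ofReal {Ω : Type*} [MeasurableSpace Ω] {μ : Measure Ω} [IsFiniteMeasure μ] {X : Ω → ℝ} (ε : ℝ)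
    {t B : ℝ} (ht : 0 ≤ t) (hI : ∫ ω, Real.exp (t * X ω) ∂μ ≠ 0) (hB : Real.exp (-t * ε) * ∫ ω, Real.exp (t * X ω) ∂μ ≤ B) :
    μ {ω | ε ≤ X ω} ≤ ENNReal.ofReal B := by
  have hint : Integrable (fun ω => Real.exp (t * X ω)) μ := by by_contra h; exact hI (integral_undef h)
  rw [← ofReal_measureReal (measure_ne_top μ _)]
  exact ENNReal.ofReal_le_ofReal ((measure_ge_le_exp_mul_mgf ε ht hint).trans hB)

/-- Sub-Gaussian tail of one coordinate of the total momentum: `P(c ∑ᵢ wᵢₖ ≥ nρ) ≤ e^{-nρ²/2}`, `c = ±1`, `ρ ≥ 0`. -/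
theorem tail_momentum (N : ℕ) (k : Fin 3) {c ρ : ℝ} (hc : c ^ 2 = 1) (hρ : 0 ≤ ρ) :
    piGauss N {w | ((N : ℝ) + 1) * ρ ≤ c * ∑ i, w i k} ≤ ENNReal.ofReal (Real.exp (-(((N : ℝ) + 1) * ρ ^ 2 / 2))) := by
  have hmgf : ∫ w, Real.exp (ρ * (c * ∑ i, w i k)) ∂piGauss N = Real.exp (ρ ^ 2 / 2) ^ (N + 1) := by
    simp_rw [← mul_assoc]
    rw [integral_exp_mul_sum_coord', mul_pow, hc, mul_one]
  refine measure_ge_le_ofReal _ hρ (by rw [hmgf]; positivity) (le_of_eq ?_)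
  rw [hmgf, ← Real.exp_nat_mul, ← Real.exp_add]; congr 1; push_cast; ring

/-- Sub-exponential tails of the kinetic energy: `P(c (∑ᵢ ‖wᵢ‖² - 3n) ≥ 3nr) ≤ e^{-nr²/4}`, `c = ±1`, `0 ≤ r ≤ 3/2`. -/
theorem tail_energy (N : ℕ) {c r : ℝ} (hc : c ^ 2 = 1) (hr0 : 0 ≤ r) (hr : r ≤ 3 / 2) :
    piGauss N {w | 3 * ((N : ℝ) + 1) * (r + c) ≤ c * ∑ i, ‖w i‖ ^ 2} ≤
      ENNReal.ofReal (Real.exp (-(((N : ℝ) + 1) * r ^ 2 / 4))) := by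
  have habs : |c| = 1 := (pow_eq_one_iff_of_nonneg (abs_nonneg c) two_ne_zero).1 (by rw [← sq_abs] at hc; exact hc)
  have hβ : r / 6 * c < 1 / 2 := by
    calc r / 6 * c ≤ |r / 6 * c| := le_abs_self _
      _ = r / 6 := by rw [abs_mul, habs, mul_one, abs_of_nonneg (by positivity)]
      _ < 1 / 2 := by linarith
  have hmgf : ∫ w, Real.exp (r / 6 * (c * ∑ i, ‖w i‖ ^ 2)) ∂piGauss N = ((Real.sqrt (1 - 2 * (r / 6 * c)))⁻¹ ^ 3) ^ (N + 1) := by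
    have h1 : ∀ w : Fin (N + 1) → V3, Real.exp (r / 6 * (c * ∑ i, ‖w i‖ ^ 2)) = Real.exp (r / 6 * c * ∑ i, ‖w i‖ ^ 2) :=
      fun w => by rw [mul_assoc]
    simp_rw [h1]
    exact integral_exp_mul_sum_norm_sq N hβ
  have hpos : 0 < (Real.sqrt (1 - 2 * (r / 6 * c)))⁻¹ ^ 3 := pow_pos (inv_pos.2 (Real.sqrt_pos.2 (by linarith))) 3
  refine measure_ge_le_ofReal _ (by positivity : (0 : ℝ) ≤ r / 6) (by rw [hmgf]; positivity) ?_
  rw [hmgf]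
  calc Real.exp (-(r / 6) * (3 * ((N : ℝ) + 1) * (r + c))) * ((Real.sqrt (1 - 2 * (r / 6 * c)))⁻¹ ^ 3) ^ (N + 1)
      = (Real.exp (-(r / 6) * (3 * (r + c))) * ((Real.sqrt (1 - 2 * (r / 6 * c)))⁻¹ ^ 3)) ^ (N + 1) := by
        rw [mul_pow, ← Real.exp_nat_mul]; congr 2; push_cast; ring
    _ ≤ Real.exp (-(r ^ 2 / 4)) ^ (N + 1) := pow_le_pow_left₀ (by positivity) (energy_oneBody_bound hc hr0 hr) _
    _ = _ := by rw [← Real.exp_nat_mul]; congr 1; push_cast; ring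

/-- **Shell tail**: `P(ω̃ ≥ v) ≤ 8 e^{-nv/12}` for the reduced shell distance `ω̃ = min 1 (‖n⁻¹∑wᵢ‖² + (n⁻¹∑‖wᵢ‖²/3 - 1)²)`,
`0 ≤ v ≤ 1` (union bound over `±` each momentum coordinate at `ρ = √(v/6)` and `±` the energy at `r = √(v/2)`). -/
theorem tail_shell (N : ℕ) {v : ℝ} (hv0 : 0 ≤ v) (hv1 : v ≤ 1) :
    piGauss N {w | v ≤ min 1 (‖((N : ℝ) + 1)⁻¹ • ∑ i, w i‖ ^ 2 + (((N : ℝ) + 1)⁻¹ * (∑ i, ‖w i‖ ^ 2) / 3 - 1) ^ 2)} ≤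
      ENNReal.ofReal (8 * Real.exp (-(((N : ℝ) + 1) * v / 12))) := by
  set n : ℝ := (N : ℝ) + 1 with hn
  have hnpos : 0 < n := by positivity
  set ρ : ℝ := Real.sqrt (v / 6) with hρ
  set r : ℝ := Real.sqrt (v / 2) with hr
  have hρ2 : ρ ^ 2 = v / 6 := Real.sq_sqrt (by positivity)
  have hr2 : r ^ 2 = v / 2 := Real.sq_sqrt (by positivity)
  set M : Fin 3 → ℝ → Set (Fin (N + 1) → V3) := fun k c => {w | n * ρ ≤ c * ∑ i, w i k} with hM
  set E : ℝ → Set (Fin (N + 1) → V3) := fun c => {w | 3 * n * (r + c) ≤ c * ∑ i, ‖w i‖ ^ 2} with hE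
  set e : ℝ≥0∞ := ENNReal.ofReal (Real.exp (-(n * v / 12))) with he
  have hmom : ∀ (k : Fin 3) (c : ℝ), c ^ 2 = 1 → piGauss N (M k c) ≤ e := by
    intro k c hc
    refine (tail_momentum N k hc (Real.sqrt_nonneg _)).trans (le_of_eq ?_)
    rw [he, hρ2]
    congr 2
    ring
  have hen : ∀ c : ℝ, c ^ 2 = 1 → piGauss N (E c) ≤ e := by
    intro c hc
    refine (tail_energy N hc (Real.sqrt_nonneg _) (Real.sqrt_le_iff.2 ⟨by norm_num, by linarith⟩)).trans
      (ENNReal.ofReal_le_ofReal (Real.exp_le_exp.2 ?_))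
    rw [hr2]
    nlinarith
  have hsub : {w : Fin (N + 1) → V3 | v ≤ min 1 (‖n⁻¹ • ∑ i, w i‖ ^ 2 + (n⁻¹ * (∑ i, ‖w i‖ ^ 2) / 3 - 1) ^ 2)} ⊆
      (⋃ k : Fin 3, (M k 1 ∪ M k (-1))) ∪ (E 1 ∪ E (-1)) := by
    intro w hw
    have hX := (mem_setOf_eq ▸ hw).trans (min_le_right _ _)
    simp only [mem_union, mem_iUnion, hM, hE, mem_setOf_eq]
    by_cases h1 : v / 2 ≤ (n⁻¹ * (∑ i, ‖w i‖ ^ 2) / 3 - 1) ^ 2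
    · right
      have hab : r ≤ |n⁻¹ * (∑ i, ‖w i‖ ^ 2) / 3 - 1| := by
        rw [hr, ← Real.sqrt_sq_eq_abs]
        exact Real.sqrt_le_sqrt h1
      rw [show n⁻¹ * (∑ i, ‖w i‖ ^ 2) / 3 - 1 = ((∑ i, ‖w i‖ ^ 2) - 3 * n) / (3 * n) by field_simp, abs_div,
        abs_of_pos (by positivity : (0 : ℝ) < 3 * n), le_div_iff₀ (by positivity)] at hab
      rcases le_abs.1 hab with h | h
      · left; linarith
      · right; linarith
    · left
      have h2 : v / 2 ≤ ‖n⁻¹ • ∑ i, w i‖ ^ 2 := by linarith [not_le.1 h1]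
      rw [norm_smul, mul_pow, Real.norm_eq_abs, abs_of_pos (inv_pos.2 hnpos), BoltzmannGreenKuboForallN.norm_sq_eq_three,
        inv_pow, le_inv_mul_iff₀ (by positivity)] at h2
      by_contra hcon
      simp only [not_exists, not_or, not_le] at hcon
      have hk : ∀ k : Fin 3, ((∑ i, w i) k) ^ 2 < n ^ 2 * (v / 6) := fun k => by
        obtain ⟨hA, hB⟩ := hcon k
        rw [← Finset.sum_apply, ← WithLp.ofLp_sum] at hA hB
        rw [← hρ2, ← mul_pow, ← sq_abs]
        exact pow_lt_pow_left₀ (abs_lt.2 ⟨by linarith, by linarith⟩) (abs_nonneg _) two_ne_zero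
      linarith [hk 0, hk 1, hk 2]
  calc piGauss N _ ≤ piGauss N _ := measure_mono hsub
    _ ≤ (∑ k : Fin 3, piGauss N (M k 1 ∪ M k (-1))) + (piGauss N (E 1) + piGauss N (E (-1))) :=
        (measure_union_le _ _).trans (add_le_add (measure_iUnion_fintype_le _ _) (measure_union_le _ _))
    _ ≤ (∑ _k : Fin 3, (e + e)) + (e + e) :=
        add_le_add (Finset.sum_le_sum fun k _ => (measure_union_le _ _).trans
          (add_le_add (hmom k 1 (by norm_num)) (hmom k (-1) (by norm_num)))) (add_le_add (hen 1 (by norm_num)) (hen (-1) (by norm_num)))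
    _ = ENNReal.ofReal (8 * Real.exp (-(n * v / 12))) := by
        rw [Finset.sum_const, Finset.card_univ, Fintype.card_fin, nsmul_eq_mul, he, ENNReal.ofReal_mul (by norm_num : (0 : ℝ) ≤ 8),
          ENNReal.ofReal_ofNat]
        push_cast
        ring

/-- **Layer cake on a finite grid**: `∫ exp(A n ω̃) dγ ≤ e^{δ n}` for `0 ≤ A ≤ 1/12`, `δ > 0` and `n = N + 1 ≥ N₀(A, δ)`. -/
theorem lintegral_exp_shell_le {A δ : ℝ} (hA0 : 0 ≤ A) (hA : A ≤ 1 / 12) (hδ : 0 < δ) :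
    ∃ N₀ : ℕ, ∀ N : ℕ, N₀ ≤ N →
      ∫⁻ w, ENNReal.ofReal (Real.exp (A * (((N : ℝ) + 1) *
          min 1 (‖((N : ℝ) + 1)⁻¹ • ∑ i, w i‖ ^ 2 + (((N : ℝ) + 1)⁻¹ * (∑ i, ‖w i‖ ^ 2) / 3 - 1) ^ 2)))) ∂piGauss N ≤
        ENNReal.ofReal (Real.exp (δ * ((N : ℝ) + 1))) := by
  set J : ℕ := ⌈4 * A / δ⌉₊ + 1 with hJ
  have hJpos : (0 : ℝ) < J := by rw [hJ]; positivity
  have hAJ : A / J ≤ δ / 4 := by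
    have h1 : 4 * A / δ ≤ J := by rw [hJ]; push_cast; exact (Nat.le_ceil _).trans (le_add_of_nonneg_right zero_le_one)
    rw [div_le_iff₀ hδ] at h1
    rw [div_le_iff₀ hJpos]
    linarith
  refine ⟨⌈4 * Real.log (8 * ((J : ℝ) + 1)) / (3 * δ)⌉₊, fun N hN => ?_⟩
  set n : ℝ := (N : ℝ) + 1 with hn
  have hnpos : 0 < n := by positivity
  have hNn : 4 * Real.log (8 * ((J : ℝ) + 1)) / (3 * δ) ≤ n := by
    rw [hn]; linarith [(Nat.le_ceil (4 * Real.log (8 * ((J : ℝ) + 1)) / (3 * δ))).trans (Nat.cast_le.2 hN)]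
  set ω : (Fin (N + 1) → V3) → ℝ := fun w => min 1 (‖n⁻¹ • ∑ i, w i‖ ^ 2 + (n⁻¹ * (∑ i, ‖w i‖ ^ 2) / 3 - 1) ^ 2) with hω
  have hωm : Measurable ω := Continuous.measurable (by rw [hω]; fun_prop)
  have hω0 : ∀ w, 0 ≤ ω w := fun w => le_min zero_le_one (by positivity)
  -- the grid functions `F j = e^{A n (j+1)/J} 1{j/J ≤ ω̃}`
  set F : ℕ → (Fin (N + 1) → V3) → ℝ≥0∞ := fun j w =>
    {w | (j : ℝ) / J ≤ ω w}.indicator (fun _ => ENNReal.ofReal (Real.exp (A * n * (((j : ℝ) + 1) / J)))) w with hF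
  have hpt : ∀ w, ENNReal.ofReal (Real.exp (A * (n * ω w))) ≤ ∑ j ∈ Finset.range (J + 1), F j w := by
    intro w
    set j₀ : ℕ := ⌊ω w * J⌋₊ with hj₀
    have hmem : j₀ ∈ Finset.range (J + 1) :=
      Finset.mem_range.2 (Nat.lt_succ_of_le (Nat.floor_le_of_le (mul_le_of_le_one_left hJpos.le (min_le_left _ _))))
    have hlow : (j₀ : ℝ) / J ≤ ω w := by
      rw [div_le_iff₀ hJpos]
      exact Nat.floor_le (mul_nonneg (hω0 w) hJpos.le)
    have hup : ω w ≤ ((j₀ : ℝ) + 1) / J := by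
      rw [le_div_iff₀ hJpos]
      exact (Nat.lt_floor_add_one _).le
    calc ENNReal.ofReal (Real.exp (A * (n * ω w))) ≤ F j₀ w := by
          rw [hF]
          simp only
          rw [indicator_of_mem (show w ∈ {w | (j₀ : ℝ) / J ≤ ω w} from hlow)]
          refine ENNReal.ofReal_le_ofReal (Real.exp_le_exp.2 ?_)
          rw [mul_assoc]
          exact mul_le_mul_of_nonneg_left (mul_le_mul_of_nonneg_left hup hnpos.le) hA0
      _ ≤ ∑ j ∈ Finset.range (J + 1), F j w := Finset.single_le_sum (f := fun j => F j w) (fun _ _ => bot_le) hmem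
  have hFm : ∀ j, Measurable (F j) := fun j => measurable_const.indicator (measurableSet_le measurable_const hωm)
  -- each level contributes at most `8 e^{A n / J}`
  have hlev : ∀ j ∈ Finset.range (J + 1), ∫⁻ w, F j w ∂piGauss N ≤ ENNReal.ofReal (8 * Real.exp (A * n / J)) := by
    intro j hj
    have hjJ : (j : ℝ) / J ≤ 1 := by
      rw [div_le_one hJpos]
      exact_mod_cast Nat.lt_succ_iff.1 (Finset.mem_range.1 hj)
    have hj0 : (0 : ℝ) ≤ (j : ℝ) / J := by positivity
    rw [hF]
    simp only
    rw [lintegral_indicator_const (measurableSet_le measurable_const hωm)]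
    calc ENNReal.ofReal (Real.exp (A * n * (((j : ℝ) + 1) / J))) * piGauss N {w | (j : ℝ) / J ≤ ω w}
        ≤ ENNReal.ofReal (Real.exp (A * n * (((j : ℝ) + 1) / J))) * ENNReal.ofReal (8 * Real.exp (-(n * ((j : ℝ) / J) / 12))) :=
          mul_le_mul' le_rfl (tail_shell N hj0 hjJ)
      _ = ENNReal.ofReal (8 * (Real.exp (A * n * (((j : ℝ) + 1) / J)) * Real.exp (-(n * ((j : ℝ) / J) / 12)))) := by
          rw [← ENNReal.ofReal_mul (Real.exp_pos _).le]
          ring_nf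
      _ ≤ ENNReal.ofReal (8 * Real.exp (A * n / J)) := by
          refine ENNReal.ofReal_le_ofReal (mul_le_mul_of_nonneg_left ?_ (by norm_num))
          rw [← Real.exp_add, Real.exp_le_exp, show A * n * (((j : ℝ) + 1) / J) + -(n * ((j : ℝ) / J) / 12) =
            A * n / J + (A - 1 / 12) * (n * ((j : ℝ) / J)) by field_simp; ring]
          nlinarith [mul_nonneg hnpos.le hj0]
  have hfin : ((J + 1 : ℕ) : ℝ) * (8 * Real.exp (A * n / J)) ≤ Real.exp (δ * n) := by
    have h1 : 8 * ((J : ℝ) + 1) ≤ Real.exp (3 * δ * n / 4) := by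
      rw [← Real.log_le_iff_le_exp (by positivity)]
      rw [div_le_iff₀ (by positivity)] at hNn
      linarith
    have h2 : Real.exp (A * n / J) ≤ Real.exp (δ * n / 4) := by
      rw [Real.exp_le_exp, show A * n / J = A / J * n by ring]
      nlinarith [mul_le_mul_of_nonneg_right hAJ hnpos.le]
    calc ((J + 1 : ℕ) : ℝ) * (8 * Real.exp (A * n / J)) = (8 * ((J : ℝ) + 1)) * Real.exp (A * n / J) := by push_cast; ring
      _ ≤ Real.exp (3 * δ * n / 4) * Real.exp (δ * n / 4) := mul_le_mul h1 h2 (Real.exp_pos _).le (Real.exp_pos _).le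
      _ = Real.exp (δ * n) := by rw [← Real.exp_add]; congr 1; ring
  calc ∫⁻ w, ENNReal.ofReal (Real.exp (A * (n * ω w))) ∂piGauss N
      ≤ ∫⁻ w, ∑ j ∈ Finset.range (J + 1), F j w ∂piGauss N := lintegral_mono hpt
    _ = ∑ j ∈ Finset.range (J + 1), ∫⁻ w, F j w ∂piGauss N := lintegral_finsetSum _ fun j _ => hFm j
    _ ≤ ∑ _j ∈ Finset.range (J + 1), ENNReal.ofReal (8 * Real.exp (A * n / J)) := Finset.sum_le_sum hlev
    _ = ENNReal.ofReal (((J + 1 : ℕ) : ℝ) * (8 * Real.exp (A * n / J))) := by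
        rw [Finset.sum_const, Finset.card_range, nsmul_eq_mul, ENNReal.ofReal_mul (by positivity : (0 : ℝ) ≤ ((J + 1 : ℕ) : ℝ)),
          ENNReal.ofReal_natCast]
    _ ≤ ENNReal.ofReal (Real.exp (δ * n)) := ENNReal.ofReal_le_ofReal hfin

/-! ## Transfer from the global Gibbs law to the product Gaussian, and the stub -/

section Transfer

open Literature.MathematicalPhysics.KineticTheory

/-- **Velocity functionals under the constant-profile Gibbs law** (`σ ≤ 1/2`) are product-Gaussian integrals: positions and
velocities are independent, the position marginal has mass one, and the velocities are i.i.d. `N(u₀, θ) = (w ↦ u₀ + √θ w)_* γ₃`. -/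
theorem lintegral_vel_localGibbsMeasure {a θ : ℝ} (ha : 0 < a) (hθ : 0 < θ) (u₀ : V3) {σ : ℝ} (hσ2 : σ ≤ 1 / 2) (N : ℕ)
    {G : (Fin (N + 1) → V3) → ℝ≥0∞} (hG : Measurable G) :
    ∫⁻ z, G (fun i => (z i).2) ∂(localGibbsMeasure σ (fun _ => a) (fun _ => u₀) (fun _ => θ) N) =
      ∫⁻ w, G (fun i => u₀ + Real.sqrt θ • w i) ∂piGauss N := by
  haveI := isProbabilityMeasure_localGibbsMeasure (a₀ := fun _ => a) (u₀ := fun _ => u₀) (θ₀ := fun _ => θ)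
    continuous_const continuous_const continuous_const (fun _ => ha) (fun _ => hθ) hσ2 N
  have hGz : Measurable fun z : Config (N + 1) (Fin 3) T3 => G (fun i => (z i).2) :=
    hG.comp (measurable_pi_lambda _ fun i => (measurable_pi_apply i).snd)
  rw [lintegral_localGibbsMeasure continuous_const continuous_const continuous_const (fun _ => ha.le) (fun _ => hθ) σ N hGz]
  have hshift : Measurable fun (w : Fin (N + 1) → V3) (i : Fin (N + 1)) => u₀ + Real.sqrt θ • w i :=
    measurable_pi_lambda _ fun i => (measurable_gaussShift u₀ θ).comp (measurable_pi_apply i)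
  have hinner : ∀ x : Fin (N + 1) → T3, ∫⁻ v, G (fun i => (zipConfig (x, v) i).2) ∂velMeasure (fun _ => u₀) (fun _ => θ) x =
      ∫⁻ w, G (fun i => u₀ + Real.sqrt θ • w i) ∂piGauss N := by
    intro x
    have hpi : velMeasure (fun _ => u₀) (fun _ => θ) x =
        (piGauss N).map (fun (w : Fin (N + 1) → V3) (i : Fin (N + 1)) => u₀ + Real.sqrt θ • w i) := by
      rw [velMeasure, piGauss, Measure.pi_map_pi (fun _ => (measurable_gaussShift u₀ θ).aemeasurable)]
      rfl
    show ∫⁻ v, G v ∂velMeasure (fun _ => u₀) (fun _ => θ) x = _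
    rw [hpi, lintegral_map hG hshift]
  simp_rw [hinner]
  have hρm : Measurable fun x : Fin (N + 1) → T3 => ENNReal.ofReal
      ((Literature.Analysis.FluidPDE.canonicalPartition (Literature.Analysis.FluidPDE.Torus.geometry (Fin 3)) (hsDiameter σ N) (N + 1)
        (localGibbsProfile (fun _ => a) (fun _ => u₀) (fun _ => θ)))⁻¹ * posWeight (fun _ => a) (hsDiameter σ N) (N + 1) x) :=
    (measurable_const.mul (measurable_posWeight continuous_const _ _)).ennreal_ofReal
  rw [lintegral_mul_const _ hρm, lintegral_posWeight_eq_one continuous_const continuous_const continuous_const (fun _ => ha.le)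
    (fun _ => hθ) σ N, one_mul]

end Transfer

attribute [local fun_prop] Literature.MathematicalPhysics.KineticTheory.continuous_configMomentum
  Literature.MathematicalPhysics.KineticTheory.continuous_configEnergy

/-- STUB 3c of line `almost-invariant-duality` (**shell Chernoff layer**): there is a universal `A₀ > 0` (`A₀ = 1/12`) such that
under the constant-profile local Gibbs law `G_N` (`0 < σ ≤ 1/2`, `a, θ > 0`) the exponential moment of `A (N+1) ω`,
`ω = min 1 (‖p̂‖² + (ê/3 - 1)²)` the reduced distance of the empirical momentum / kinetic energy per particle to the
thermodynamic shell, is `≤ e^{δ (N+1)}` for every `0 ≤ A ≤ A₀`, `δ > 0` and `N ≥ N₀(A, δ)`: velocity product structure of `G_N`,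
Gaussian Chernoff tails for the sample mean and the sample energy, and a layer cake over a finite grid (see the module docstring).
It replaces the Gärtner–Ellis / Cramér upper bound of Dembo–Zeitouni Thm 2.2.30 by explicit constants. -/
theorem stub_shellChernoff :
    ∃ A₀ : ℝ, 0 < A₀ ∧ ∀ (σ a θ : ℝ) (u₀ : V3), 0 < σ → σ ≤ 1 / 2 → 0 < a → 0 < θ →
      ∀ A : ℝ, 0 ≤ A → A ≤ A₀ → ∀ δ : ℝ, 0 < δ → ∃ N₀ : ℕ, ∀ N : ℕ, N₀ ≤ N →
        ∀ Φ : HardSphereFlow (Literature.Analysis.FluidPDE.Torus.geometry (Fin 3)) (hsDiameter σ N) (N + 1),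
          ∫ z, Real.exp (A * (((N : ℝ) + 1) *
            min 1 (‖(Real.sqrt θ)⁻¹ • ((((N : ℝ) + 1))⁻¹ • (configMomentum z) - u₀)‖ ^ 2 +
              ((θ * ((N : ℝ) + 1))⁻¹ * (2 * (configEnergy z) - 2 * inner ℝ u₀ (configMomentum z) + ((N : ℝ) + 1) * ‖u₀‖ ^ 2) / 3 - 1) ^ 2)))
            ∂(localGibbsLaw σ (fun _ => a) (fun _ => u₀) (fun _ => θ) N Φ) ≤ Real.exp (δ * ((N : ℝ) + 1)) := by
  refine ⟨1 / 12, by norm_num, ?_⟩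
  intro σ a θ u₀ hσ hσ2 ha hθ A hA0 hA δ hδ
  obtain ⟨N₀, hN₀⟩ := lintegral_exp_shell_le hA0 hA hδ
  refine ⟨N₀, fun N hN Φ => ?_⟩
  rw [Literature.MathematicalPhysics.KineticTheory.localGibbsLaw_eq]
  haveI := Literature.MathematicalPhysics.KineticTheory.isProbabilityMeasure_localGibbsMeasure (a₀ := fun _ => a)
    (u₀ := fun _ => u₀) (θ₀ := fun _ => θ) continuous_const continuous_const continuous_const (fun _ => ha) (fun _ => hθ) hσ2 N
  set n : ℝ := (N : ℝ) + 1 with hn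
  have hnpos : 0 < n := by positivity
  have hsθ : 0 < Real.sqrt θ := Real.sqrt_pos.2 hθ
  rw [integral_eq_lintegral_of_nonneg_ae (ae_of_all _ fun z => (Real.exp_pos _).le)
    (Continuous.measurable (by fun_prop)).aestronglyMeasurable]
  refine ENNReal.toReal_le_of_le_ofReal (Real.exp_pos _).le ?_
  -- the integrand as a (measurable) functional `G` of the velocities, and `G` in the reduced velocities `w`
  have hGm : Measurable fun v : Fin (N + 1) → V3 => ENNReal.ofReal (Real.exp (A * (n *
      min 1 (‖(Real.sqrt θ)⁻¹ • (n⁻¹ • (∑ i, v i) - u₀)‖ ^ 2 +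
        ((θ * n)⁻¹ * (2 * (2⁻¹ * ∑ i, ‖v i‖ ^ 2) - 2 * inner ℝ u₀ (∑ i, v i) + n * ‖u₀‖ ^ 2) / 3 - 1) ^ 2)))) :=
    (Continuous.measurable (by fun_prop)).ennreal_ofReal
  have hP : ∀ w : Fin (N + 1) → V3, (Real.sqrt θ)⁻¹ • (n⁻¹ • (∑ i, (u₀ + Real.sqrt θ • w i)) - u₀) = n⁻¹ • ∑ i, w i := by
    intro w
    rw [Finset.sum_add_distrib, Finset.sum_const, Finset.card_univ, Fintype.card_fin, ← Finset.smul_sum, ← Nat.cast_smul_eq_nsmul ℝ,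
      smul_add, smul_smul, show (n⁻¹ * ((N + 1 : ℕ) : ℝ)) = 1 by push_cast; rw [hn]; field_simp, one_smul, add_sub_cancel_left,
      smul_smul, smul_smul]
    congr 1
    field_simp
  have hE0 : ∀ v : Fin (N + 1) → V3, 2 * (2⁻¹ * ∑ i, ‖v i‖ ^ 2) - 2 * inner ℝ u₀ (∑ i, v i) + n * ‖u₀‖ ^ 2 = ∑ i, ‖v i - u₀‖ ^ 2 := by
    intro v
    have hpt : ∀ i, ‖v i - u₀‖ ^ 2 = ‖v i‖ ^ 2 - 2 * inner ℝ u₀ (v i) + ‖u₀‖ ^ 2 := fun i => by rw [norm_sub_sq_real, real_inner_comm]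
    simp only [hpt, Finset.sum_add_distrib, Finset.sum_sub_distrib, Finset.sum_const, Finset.card_univ, Fintype.card_fin, nsmul_eq_mul,
      ← Finset.mul_sum, inner_sum, hn]
    push_cast
    ring
  have hE : ∀ w : Fin (N + 1) → V3, (θ * n)⁻¹ * (2 * (2⁻¹ * ∑ i, ‖u₀ + Real.sqrt θ • w i‖ ^ 2) -
      2 * inner ℝ u₀ (∑ i, (u₀ + Real.sqrt θ • w i)) + n * ‖u₀‖ ^ 2) = n⁻¹ * ∑ i, ‖w i‖ ^ 2 := by
    intro w
    rw [hE0]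
    simp only [add_sub_cancel_left, norm_smul, mul_pow, Real.norm_eq_abs, sq_abs, Real.sq_sqrt hθ.le, ← Finset.mul_sum]
    field_simp
  calc _ = ∫⁻ w, _ ∂piGauss N := lintegral_vel_localGibbsMeasure ha hθ u₀ hσ2 N hGm
    _ = ∫⁻ w, ENNReal.ofReal (Real.exp (A * (n * min 1 (‖n⁻¹ • ∑ i, w i‖ ^ 2 + (n⁻¹ * (∑ i, ‖w i‖ ^ 2) / 3 - 1) ^ 2)))) ∂piGauss N := by
        refine lintegral_congr fun w => ?_
        simp only [hP, hE]
    _ ≤ ENNReal.ofReal (Real.exp (δ * n)) := hN₀ N hN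

end Summit.AtomisticToContinuum.HydrodynamicLimit.Theorems.AlmostInvariantDuality

end
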